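import Summits.Ventures.HSemireg.DecomposableTwoForms
import Summits.Ventures.HSemireg.DividedSquareLemma
import Summits.Ventures.HSemireg.TwoAdicReadings

/-!
# Divided-square parity: `B·B ∈ 4Λ` ⇒ `B = ι a · ι b + 2X` (pub-hsemireg, S4-PUSH corner 2)

Kernel leg of seat s4-search-2 gen 17 (cell `pub-hsemireg`), ROW P; companion of `DecomposableTwoForms.lean`
(ROW O: «rank `≤ 2` ⇒ decomposable», precision S-N-2 of s4-ref g48 V#7 as a theorem).  ROW O turns a 2-form whose
coefficient array satisfies the Plücker relations modulo `2` into `ι a ι b + 2X`; this file supplies those relations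
from the ONE hypothesis the CLASS-DEAD rows actually produce at `k = 2`: the square of the class 2-form is divisible
by `4` (equivalently: its divided square `B^[2]`, `B·B = 2B^[2]`, is EVEN).

**Statements.**  `M` free with a basis `x : n → M` (`n` a finite linear order; `Fin 12` in the application).
* `pfaffian_even_of_sq_eq_four_mul`: for an alternating integer array `c` and `B = Σ_{a<b} c a b · ι x_a ι x_b`, if
  `B·B = 4·W` for some `W` then every `4 × 4` Pfaffian `c i j·c k l − c i k·c j l + c i l·c j k` is even.
* `exists_eq_ι_mul_ι_add_two_mul_of_sq`: for ANY `B` in the `ℤ`-span of the 2-vectors with `B·B = 4·W`: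
  `B = ι a · ι b + 2·X` with `a, b ∈ M` and `X` in the span of the 2-vectors (by `DecomposableTwoForms.exists_coeff_of_mem_span`,
  the previous theorem and `DecomposableTwoForms.exists_eq_ι_mul_ι_add_two_mul`).

**Mechanism.**  For distinct `i, j, k, l` push `B` along the coordinate projection `π : M → ℤ⁴` onto
`x_i, x_j, x_k, x_l` (`LinearMap.pi` of `Module.Basis.coord`, then `ExteriorAlgebra.map π`): every `ι x_a` with `a`
outside `{i, j, k, l}` dies, and the image is the six-term 2-vector on `e₀, …, e₃` carrying the coefficients of `c`
inside `{i, j, k, l}` (`Finset.sum_subset` ∕ `Finset.sum_image` and the symmetrisation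
`DecomposableTwoForms.sum_sum_eq_upper_add_diag`; alternation of `c` makes the order of `i, j, k, l` irrelevant).  Its
square is `2·Pf·e₀e₁e₂e₃` by the tree's `DividedSquareLemma.sq_eq_two_mul_pfaffian_smul`, and the top coefficient
`τ` of `Λ(ℤ⁴)` (`TwoAdicReadings.exists_topCoeff`, `apply_ofNat_mul`, `apply_intCast_mul`) reads the integer equation
`4·τ(πW) = 2·Pf`.  Coincident indices: the Pfaffian of an alternating array vanishes identically.

Scope ∕ honest framing: multilinear algebra over `ℤ` (count-neutral, theorems only, no `def`); with ROW O it removes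
the framework word «leading digit of rank `≤ 2`» from the CLASS-DEAD theorems of the `E = ∅` units — see
`LemmaCEveryDigit.lean` ∕ `DimZeroEveryDigit.lean` (ROWS Q ∕ R), where CRITERION L at `k = 2` itself yields
`B·B ∈ 4Λ`.  CRITERION L as the registered necessary condition, the signature table and the census remain framework
words of `s4push/search-2/`; no object, no `σ` computation, no Hodge statement; nothing here bears on HC ∕ HC_CM ∕ HC_AV.
-/

namespace Summit.Ventures.HSemireg.DividedSquareParity

open ExteriorAlgebra DecomposableTwoForms TwoAdicReadings

section Degenerate

variable {R : Type*} [CommRing R] {n : Type*}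

/-- Four pairwise distinct indices give an injective `![i, j, k, l]`. -/
theorem injective_vecFour {i j k l : n} (hij : i ≠ j) (hik : i ≠ k) (hil : i ≠ l) (hjk : j ≠ k)
    (hjl : j ≠ l) (hkl : k ≠ l) : Function.Injective ![i, j, k, l] := by
  intro r s h
  fin_cases r <;> fin_cases s <;>
    simp [hij, hik, hil, hjk, hjl, hkl, hij.symm, hik.symm, hil.symm, hjk.symm, hjl.symm, hkl.symm] at h ⊢

end Degenerate

section Parity

variable {M : Type*} [AddCommGroup M] [Module ℤ M] {n : Type*} [LinearOrder n] [Fintype n]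

/-- **The Pfaffians of `c` are even when `B·B ∈ 4Λ`.**  `x` a basis, `c` an alternating integer array,
`B = Σ_{a<b} c a b · ι x_a ι x_b`; if `B·B = 4·W` for some `W` (anything in the exterior algebra), then every
`4 × 4` Pfaffian `c i j·c k l − c i k·c j l + c i l·c j k` is even.  Mechanism: for distinct `i, j, k, l` push `B`
along the coordinate projection `π : M → ℤ⁴` onto `x_i, x_j, x_k, x_l` (`ExteriorAlgebra.map`); the image is the
six-term 2-vector on `e₀, …, e₃` with the coefficients of `c` inside `{i, j, k, l}`, whose square is
`2·Pf·e₀e₁e₂e₃` (`DividedSquareLemma.sq_eq_two_mul_pfaffian_smul`); the top coefficient `τ`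
(`TwoAdicReadings.exists_topCoeff`) reads `2·Pf = 4·τ(π W)`.  Coincident indices: `Pf = 0` by alternation. -/
theorem pfaffian_even_of_sq_eq_four_mul (x : Module.Basis n ℤ M) (c : n → n → ℤ) (h0 : ∀ i, c i i = 0)
    (hskew : ∀ i j, c j i = -c i j) (B W : ExteriorAlgebra ℤ M)
    (hB : B = ∑ a, ∑ b, if a < b then (c a b : ExteriorAlgebra ℤ M) * (ι ℤ (x a) * ι ℤ (x b)) else 0)
    (hBB : B * B = 4 * W) (i j k l : n) :
    (2 : ℤ) ∣ c i j * c k l - c i k * c j l + c i l * c j k := by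
  -- coincident indices: the Pfaffian vanishes identically
  by_cases hij : i = j
  · subst hij; exact ⟨0, by rw [h0 i]; ring⟩
  by_cases hik : i = k
  · subst hik; exact ⟨0, by rw [h0 i, hskew i j]; ring⟩
  by_cases hil : i = l
  · subst hil; exact ⟨0, by rw [h0 i, hskew i k, hskew i j]; ring⟩
  by_cases hjk : j = k
  · subst hjk; exact ⟨0, by rw [h0 j]; ring⟩
  by_cases hjl : j = l
  · subst hjl; exact ⟨0, by rw [h0 j, hskew j k]; ring⟩
  by_cases hkl : k = l
  · subst hkl; exact ⟨0, by rw [h0 k]; ring⟩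
  -- distinct indices
  set f : Fin 4 → n := ![i, j, k, l] with hf
  have hinj : Function.Injective f := injective_vecFour hij hik hil hjk hjl hkl
  -- the coordinate projection onto `x_i, x_j, x_k, x_l`
  set π : M →ₗ[ℤ] (Fin 4 → ℤ) := LinearMap.pi fun r => x.coord (f r) with hπdef
  set e : Fin 4 → (Fin 4 → ℤ) := fun r => Pi.single r 1 with he
  have hπ : ∀ a, π (x a) = fun r => if a = f r then (1 : ℤ) else 0 := by
    intro a; funext r
    simp [hπdef, Finsupp.single_apply]
  have hπ0 : ∀ a, (∀ r, a ≠ f r) → π (x a) = 0 := by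
    intro a ha; rw [hπ]; funext r; simp [ha r]
  have hπf : ∀ r, π (x (f r)) = e r := by
    intro r; rw [hπ]; funext s
    simp [he, Pi.single_apply, hinj.eq_iff, eq_comm]
  -- the image of `B`
  set Λ₄ := ExteriorAlgebra ℤ (Fin 4 → ℤ)
  set g : n → n → Λ₄ := fun a b =>
    if a < b then (c a b : Λ₄) * (ι ℤ (π (x a)) * ι ℤ (π (x b))) else 0 with hg
  have hmap : ExteriorAlgebra.map π B = ∑ a, ∑ b, g a b := by
    rw [hB, map_sum]
    refine Finset.sum_congr rfl fun a _ => ?_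
    rw [map_sum]
    refine Finset.sum_congr rfl fun b _ => ?_
    simp only [hg]
    split_ifs
    · rw [map_mul, map_intCast, map_mul, map_apply_ι, map_apply_ι]
    · rw [map_zero]
  have hga : ∀ a, (∀ r, a ≠ f r) → ∀ b, g a b = 0 := by
    intro a ha b; simp only [hg, hπ0 a ha, map_zero, zero_mul, mul_zero, ite_self]
  have hgb : ∀ b, (∀ r, b ≠ f r) → ∀ a, g a b = 0 := by
    intro b hb a; simp only [hg, hπ0 b hb, map_zero, mul_zero, ite_self]
  set S : Finset n := Finset.univ.image f with hS
  have hnS : ∀ a, a ∉ S → ∀ r, a ≠ f r := by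
    intro a ha r har
    exact ha (Finset.mem_image.mpr ⟨r, Finset.mem_univ _, har.symm⟩)
  have h1 : ∑ a, ∑ b, g a b = ∑ a ∈ S, ∑ b ∈ S, g a b := by
    rw [← Finset.sum_subset (Finset.subset_univ S)
      (fun a _ ha => Finset.sum_eq_zero fun b _ => hga a (hnS a ha) b)]
    refine Finset.sum_congr rfl fun a _ => ?_
    exact (Finset.sum_subset (Finset.subset_univ S) fun b _ hb => hgb b (hnS b hb) a).symm
  have h2 : ∑ a ∈ S, ∑ b ∈ S, g a b = ∑ r, ∑ s, g (f r) (f s) := by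
    rw [hS, Finset.sum_image fun r _ s _ h => hinj h]
    refine Finset.sum_congr rfl fun r _ => ?_
    rw [Finset.sum_image fun r _ s _ h => hinj h]
  have h3 : ∑ r, ∑ s, g (f r) (f s)
      = ∑ r, ∑ s, if r < s then (c (f r) (f s) : Λ₄) * (ι ℤ (e r) * ι ℤ (e s)) else 0 := by
    simp only [hg, hπf]
    rw [sum_sum_eq_upper_add_diag (fun r s =>
      if f r < f s then (c (f r) (f s) : Λ₄) * (ι ℤ (e r) * ι ℤ (e s)) else 0)]
    simp only [lt_self_iff_false, if_false, Finset.sum_const_zero, add_zero]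
    refine Finset.sum_congr rfl fun r _ => Finset.sum_congr rfl fun s _ => ?_
    by_cases hrs : r < s
    · simp only [hrs, if_true]
      rcases lt_trichotomy (f r) (f s) with h | h | h
      · simp [h, not_lt.mpr h.le]
      · exact absurd (hinj h) hrs.ne
      · simp only [h, not_lt.mpr h.le, if_true, if_false, zero_add]
        rw [hskew (f r) (f s), Int.cast_neg, ι_mul_ι_swap (e r) (e s), neg_mul_neg]
    · simp only [hrs, if_false]
  have h4 : (∑ r, ∑ s, if r < s then (c (f r) (f s) : Λ₄) * (ι ℤ (e r) * ι ℤ (e s)) else 0)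
      = (c i j : Λ₄) * (ι ℤ (e 0) * ι ℤ (e 1)) + (c i k : Λ₄) * (ι ℤ (e 0) * ι ℤ (e 2))
        + (c i l : Λ₄) * (ι ℤ (e 0) * ι ℤ (e 3)) + (c j k : Λ₄) * (ι ℤ (e 1) * ι ℤ (e 2))
        + (c j l : Λ₄) * (ι ℤ (e 1) * ι ℤ (e 3)) + (c k l : Λ₄) * (ι ℤ (e 2) * ι ℤ (e 3)) := by
    simp only [Fin.sum_univ_four, hf]
    simp [Fin.lt_def]
    abel
  have hB' : ExteriorAlgebra.map π B
      = (c i j : Λ₄) * (ι ℤ (e 0) * ι ℤ (e 1)) + (c i k : Λ₄) * (ι ℤ (e 0) * ι ℤ (e 2))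
        + (c i l : Λ₄) * (ι ℤ (e 0) * ι ℤ (e 3)) + (c j k : Λ₄) * (ι ℤ (e 1) * ι ℤ (e 2))
        + (c j l : Λ₄) * (ι ℤ (e 1) * ι ℤ (e 3)) + (c k l : Λ₄) * (ι ℤ (e 2) * ι ℤ (e 3)) := by
    rw [hmap, h1, h2, h3, h4]
  -- the square of the image: `2·Pf·e₀e₁e₂e₃`
  have hsq := DividedSquareLemma.sq_eq_two_mul_pfaffian_smul (R := ℤ) (e 0) (e 1) (e 2) (e 3)
    (c i j) (c i k) (c i l) (c j k) (c j l) (c k l)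
  simp only [Algebra.smul_def, eq_intCast] at hsq
  rw [← hB', sq, ← map_mul, hBB, map_mul, map_ofNat] at hsq
  -- read the top coefficient
  obtain ⟨τ, hτ⟩ := exists_topCoeff ℤ 4
  have htop : ι ℤ (e 0) * ι ℤ (e 1) * (ι ℤ (e 2) * ι ℤ (e 3)) = ιMulti ℤ 4 e := by
    rw [ιMulti_apply]; simp [List.ofFn_succ, he, mul_assoc]
  have key := congrArg τ hsq
  rw [htop, apply_ofNat_mul τ 4, apply_intCast_mul, hτ, mul_one] at key
  have k4 : (4 : ℤ) * τ (ExteriorAlgebra.map π W) = 2 * (c i j * c k l - c i k * c j l + c i l * c j k) := key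
  exact ⟨τ (ExteriorAlgebra.map π W), by linarith⟩

/-- **`B·B ∈ 4Λ` ⇒ `B = ι a · ι b + 2X`.**  For ANY integral 2-form `B` (element of the `ℤ`-span of the 2-vectors
of a free module with a finite basis): if `B·B = 4·W` for some `W`, then `B = ι a · ι b + 2·X` with `a, b ∈ M` and
`X` in the span of the 2-vectors — the leading digit of `B` is decomposable.  (`B·B = 2B^[2]` always; the
hypothesis says the divided square `B^[2]` is EVEN, and an even divided square means vanishing Pfaffians modulo 2,
`pfaffian_even_of_sq_eq_four_mul`, whence `DecomposableTwoForms.exists_eq_ι_mul_ι_add_two_mul`.) -/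
theorem exists_eq_ι_mul_ι_add_two_mul_of_sq (x : Module.Basis n ℤ M) (B W : ExteriorAlgebra ℤ M)
    (mB : B ∈ Submodule.span ℤ (Set.range fun p : M × M => ι ℤ p.1 * ι ℤ p.2)) (hBB : B * B = 4 * W) :
    ∃ a b : M, ∃ X ∈ Submodule.span ℤ (Set.range fun p : M × M => ι ℤ p.1 * ι ℤ p.2),
      B = ι ℤ a * ι ℤ b + 2 * X := by
  obtain ⟨c, h0, hskew, rfl⟩ := exists_coeff_of_mem_span x B mB
  exact exists_eq_ι_mul_ι_add_two_mul x c fun i j k l => (ZMod.intCast_zmod_eq_zero_iff_dvd _ 2).mpr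
    (by exact_mod_cast pfaffian_even_of_sq_eq_four_mul x c h0 hskew _ W rfl hBB i j k l)

end Parity

end Summit.Ventures.HSemireg.DividedSquareParity
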